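import Summits.ResolutionOfSingularities.ResolutionOfSingularities.Theorems.FrobeniusLadderFInjectiveMacaulayficationE8Char5FiModel
import Summits.ResolutionOfSingularities.ResolutionOfSingularities.Theorems.FrobeniusLadderFInjectiveMacaulayficationWFixAtNonClosedDimTwo
import Summits.ResolutionOfSingularities.ResolutionOfSingularities.Theorems.FrobeniusLadderFInjectiveMacaulayficationFiLocusOpenOfAffine
import Literature.AlgebraicGeometry.Resolution.AffineBlowupAlgebra
import HarnessLib

/-!
# Prime-local clause facts pass between the two models `R[I/a]` and `(R[It])_{(at)}` of a blow-up chart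
# (crux `FInjectiveMacaulayfication` stmt-ResolutionOfSingularities-15315, chain w45a; generic glue for the S′-assembly of F4POS-1 (d); seat res-L1-w45a-stub-1 g10)

[OURS · L1 W4.5a] Support file (`--supports stmt-ResolutionOfSingularities-15315 --as helper`); def-free, unconditional, generic; replaces the role of NO printed
item; NOT a statement of the manuscript; AI-written (AI review is weaker than expert review).

`StalkChartIso.stub_stalkChartIso` reads the stalks of `affineBlowup I` in the Proj chart rings `(R[It])_{(at)} = HomogeneousLocalization.Away (reesGrading I) (reesT a)`,
while chart certificates are computed on `R[I/a] = blowupAlgebra I a ⊆ R[1/a]` (≅ by `reesChartEquiv`, Stacks 0804). THIS FILE moves «CM clause at every prime» and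
«`¬ FullCl p` at every prime containing the marked element `a/1`» from `R[I/a]` to `(R[It])_{(at)}` (`reesChart_facts_of_blowupAlgebra_facts`), through
`exists_reesChartEquiv` (the chart isomorphism packaged as an EXISTENTIAL — consumers obtain an opaque `e`, which keeps the localisation transport
`E8Char5FiModel.nonempty_ringEquiv_localization_comap` cheap; unfolding `reesChartEquiv` inside `Localization.AtPrime (q.comap …)` does not elaborate in budget) and
the ring-hom form `transport_ringHom` of the transport lemma. [folklore; cite: StacksProject, Tag 0804]
-/

-- single-problem summit: the doubled namespace component is forced
set_option linter.dupNamespace false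

noncomputable section

namespace Summit.ResolutionOfSingularities.ResolutionOfSingularities.Theorems.FInjectiveMacaulayfication.ReesChartFacts

open IsLocalRing Literature.AlgebraicGeometry.Resolution
open Summit.ResolutionOfSingularities.ResolutionOfSingularities.Theorems.FInjectiveMacaulayfication
open SliceableCentre

/-- The chart isomorphism `(R[It])_{(at)} ≃+* R[I/a]` over `R`, as an existential (opaque for consumers). [cite: StacksProject, Tag 0804] -/
theorem exists_reesChartEquiv {R : Type} [CommRing R] (I : Ideal R) (a : R) (ha : a ∈ I) :
    ∃ e : HomogeneousLocalization.Away (reesGrading I) (reesT a ha) ≃+* blowupAlgebra I a,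
      ∀ r : R, e (reesChartBase a ha r) = algebraMap R (blowupAlgebra I a) r :=
  ⟨reesChartEquiv a ha, reesChartEquiv_reesChartBase a ha⟩

/-- Transport of «CM at every prime» and «the marked element is bad» along a ring isomorphism compatible with given structure maps (ring-hom form).
[folklore] -/
theorem transport_ringHom {R B B' : Type} [CommRing R] [CommRing B] [CommRing B'] (iB : R →+* B) (iB' : R →+* B') (E₀ : B ≃+* B')
    (hE₀ : ∀ r : R, E₀ (iB r) = iB' r) (p : ℕ) (a : R)
    (hCM : ∀ (Q : Ideal B) [Q.IsPrime], CMCl (Localization.AtPrime Q))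
    (hbad : ∀ (Q : Ideal B) [Q.IsPrime], iB a ∈ Q → ¬ FullCl p (Localization.AtPrime Q)) :
    (∀ (Q : Ideal B') [Q.IsPrime], CMCl (Localization.AtPrime Q)) ∧
      (∀ (Q : Ideal B') [Q.IsPrime], iB' a ∈ Q → ¬ FullCl p (Localization.AtPrime Q)) := by
  refine ⟨fun Q _ => ?_, fun Q _ hQ hfull => ?_⟩
  · obtain ⟨eQ⟩ := E8Char5FiModel.nonempty_ringEquiv_localization_comap E₀ Q
    exact FiLocusOpenOfAffine.cmClause_of_ringEquiv eQ (hCM (Q.comap E₀.toRingHom))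
  · obtain ⟨eQ⟩ := E8Char5FiModel.nonempty_ringEquiv_localization_comap E₀ Q
    have ha : iB a ∈ Q.comap E₀.toRingHom := by
      rw [Ideal.mem_comap, RingEquiv.toRingHom_eq_coe, RingEquiv.coe_toRingHom, hE₀]; exact hQ
    exact hbad (Q.comap E₀.toRingHom) ha (WFixAtNonClosedDimTwo.fullCl_of_ringEquiv p eQ.symm hfull)

/-- ★ **From `R[I/a]` to `(R[It])_{(at)}`**: CM at every prime and `¬ FullCl p` at every prime containing `a/1` pass from the affine blow-up algebra to the Proj
chart ring (marked element `reesChartBase a a = a/1`). [folklore; cite: StacksProject, Tag 0804] -/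
theorem reesChart_facts_of_blowupAlgebra_facts {R : Type} [CommRing R] (I : Ideal R) (a : R) (ha : a ∈ I) (p : ℕ)
    (hCM : ∀ (Q : Ideal (blowupAlgebra I a)) [Q.IsPrime], CMCl (Localization.AtPrime Q))
    (hbad : ∀ (Q : Ideal (blowupAlgebra I a)) [Q.IsPrime], algebraMap R (blowupAlgebra I a) a ∈ Q → ¬ FullCl p (Localization.AtPrime Q)) :
    (∀ (q : Ideal (HomogeneousLocalization.Away (reesGrading I) (reesT a ha))) [q.IsPrime], CMCl (Localization.AtPrime q)) ∧
      (∀ (q : Ideal (HomogeneousLocalization.Away (reesGrading I) (reesT a ha))) [q.IsPrime],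
        reesChartBase a ha a ∈ q → ¬ FullCl p (Localization.AtPrime q)) := by
  obtain ⟨e, he⟩ := exists_reesChartEquiv I a ha
  have he' : ∀ r : R, e.symm (algebraMap R (blowupAlgebra I a) r) = reesChartBase a ha r := fun r => by
    rw [RingEquiv.symm_apply_eq, he]
  exact transport_ringHom (algebraMap R (blowupAlgebra I a)) (reesChartBase a ha) e.symm he' p a hCM hbad

/-- Transport of «CM at every prime» alone along a ring isomorphism (variable-typed; instantiate, do not unfold). [folklore] -/
theorem transport_cmCl {B B' : Type} [CommRing B] [CommRing B'] (E₀ : B ≃+* B')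
    (hCM : ∀ (Q : Ideal B) [Q.IsPrime], CMCl (Localization.AtPrime Q)) (Q : Ideal B') [Q.IsPrime] : CMCl (Localization.AtPrime Q) := by
  obtain ⟨eQ⟩ := E8Char5FiModel.nonempty_ringEquiv_localization_comap E₀ Q
  exact FiLocusOpenOfAffine.cmClause_of_ringEquiv eQ (hCM (Q.comap E₀.toRingHom))

/-- The CM half alone, from `R[I/a]` to `(R[It])_{(at)}`. [folklore] -/
theorem reesChart_cmCl_of_blowupAlgebra_cmCl {R : Type} [CommRing R] (I : Ideal R) (a : R) (ha : a ∈ I)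
    (hCM : ∀ (Q : Ideal (blowupAlgebra I a)) [Q.IsPrime], CMCl (Localization.AtPrime Q))
    (q : Ideal (HomogeneousLocalization.Away (reesGrading I) (reesT a ha))) [q.IsPrime] : CMCl (Localization.AtPrime q) := by
  obtain ⟨e, -⟩ := exists_reesChartEquiv I a ha
  exact transport_cmCl e.symm hCM q

end Summit.ResolutionOfSingularities.ResolutionOfSingularities.Theorems.FInjectiveMacaulayfication.ReesChartFacts

end
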